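import Literature.AlgebraicGeometry.Modules.InjectiveModuleFlasque
import Literature.AlgebraicGeometry.Modules.SheafHomFlasque
import Literature.AlgebraicGeometry.Modules.IsoOfFrames
import Literature.AlgebraicGeometry.HodgeTheory.AtiyahClassTraceDegreeZero
import Literature.AlgebraicGeometry.Motives.FlasqueCohomology
import Literature.AlgebraicGeometry.Motives.GrothendieckVanishingProofs
import Mathlib.Algebra.FiveLemma
import HarnessLib

/-!
# `Extⁱ_{𝒪_X}(𝒪_X, G) ≅ Hⁱ(X, G)` and `Extⁱ_{𝒪_X}(E, M) ≅ Hⁱ(X, 𝓗om(E, M))` (Hartshorne III.6.3 (c), III.6.7); vanishing above the dimension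

For a scheme `X` and an `𝒪_X`-module `G`, the comparison map
`extToCohomology G i : Extⁱ_{𝒪_X}(𝒪_X, G) → Hⁱ(X, G)` of `HodgeTheory/AtiyahClassTraceReal.lean`
(forget the module structure and precompose with the unit section `1 : ℤ_X → 𝒪_X`) is BIJECTIVE
in every degree — R. Hartshorne, *Algebraic Geometry*, III Prop. 6.3 (c) with Prop. 2.6 ("the
derived functors of `Γ(X, ·)` on `Mod(X)` coincide with `Hⁱ(X, ·)`"), by the printed proof:
`Mod(𝒪_X)` has enough injectives (`Modules/ModulesGrothendieckAbelian`), injective `𝒪_X`-modules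
are flasque (III.2.4, `Modules/InjectiveModuleFlasque`) hence `Γ`-acyclic (III.2.5,
`Motives/FlasqueCohomology`), and dimension shifting along `0 → G → ℐ → Q → 0` compares the two
long exact sequences by the four-lemma (as in Mathlib's
`Functor.mapExt_bijective_of_preservesInjectiveObjects` / the tree's `Algebra/Homology/ExtComparison`);
in degree `0` both sides are `Γ(X, G)` (`HodgeTheory.extToCohomology_mk₀_equiv₀`).

For `E` finite locally free, `extToExtUnitSheafHom : Extⁱ(E, M) → Extⁱ(𝒪_X, 𝓗om(E, M))` (apply
the exact functor `𝓗om(E, –)`, precompose with the unit `𝒪_X → 𝓔nd E`) is likewise bijective —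
III Prop. 6.7 ("`Extⁱ(ℱ ⊗ ℒ, 𝒢) ≃ Extⁱ(ℱ, ℒ^∨ ⊗ 𝒢)`", `ℱ = 𝒪_X`, `ℒ = E`, `E^∨ ⊗ M` modelled by
the internal Hom `Modules.sheafHom`): same dimension shifting, using that `𝓗om(E, ℐ)` is flasque
(`Modules/SheafHomFlasque`). Hence `Extⁱ(E, M) ≃ Hⁱ(X, 𝓗om(E, M))`, and by Grothendieck's vanishing
theorem (III.2.7, `Motives.grothendieckVanishing_holds`) **`Extⁱ_{𝒪_X}(E, M) = 0` for `i > dim X`**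
on a noetherian scheme — e.g. the obstruction groups `Ext²(E, E ⊗ 𝒪)` of vector bundles on curves.

* `app_top_one_injective/surjective` (`Hom(𝒪_X, G) ≃ Γ(X, G)`), `extToCohomology_zero_bijective`,
  `extToCohomology_comp_extClass`, `extToCohomology_bijective` (**III.6.3 (c)**),
  `extUnitAddEquivCohomology`, `subsingleton_ext_unit_of_subsingleton_H`,
  `subsingleton_ext_unit_of_topologicalKrullDim_lt`;
* `overFunctor_top_map_bijective` (`Hom(E, M) ≃ Hom(E|_⊤, M|_⊤)`), `extToExtUnitSheafHom` with its
  calculus, `extToExtUnitSheafHom_bijective` (**III.6.7**), `extAddEquivExtUnitSheafHom`,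
  `extAddEquivCohomologySheafHom`, `subsingleton_ext_of_subsingleton_H_sheafHom`,
  `subsingleton_ext_of_topologicalKrullDim_lt` (**`Extⁱ(E, M) = 0`, `i > dim X`**).

## References

* R. Hartshorne, *Algebraic Geometry*, GTM 52 (1977), III Prop. 2.6, Prop. 6.3 (c), Prop. 6.7,
  Thm. 2.7. [Hartshorne1977]
-/

universe w u

open CategoryTheory CategoryTheory.Abelian CategoryTheory.Limits Opposite TopologicalSpace
  AlgebraicGeometry
open Literature.AlgebraicGeometry.HodgeTheory Literature.AlgebraicGeometry.Motives

namespace Literature.AlgebraicGeometry.Modules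

variable {X : Scheme.{u}}

section DegreeZero

/-- For a morphism `f : 𝒪_X → G`, `f_U(1) = f_X(1)|_U`. [folklore] -/
theorem app_one_eq_map_app_top_one (G : X.Modules) (f : unitModule X ⟶ G) (U : X.Opens) :
    f.app U (1 : X.presheaf.obj (op U)) =
      G.presheaf.map (homOfLE le_top).op (f.app ⊤ (1 : X.presheaf.obj (op ⊤))) := by
  have h := PresheafOfModules.naturality_apply f.val (homOfLE (le_top (a := U))).op
    (1 : X.presheaf.obj (op ⊤))
  have h1 : ((unitModule X).val.map (homOfLE (le_top (a := U))).op) (1 : X.presheaf.obj (op ⊤)) =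
      (1 : X.presheaf.obj (op U)) :=
    map_one (X.ringCatSheaf.obj.map (homOfLE (le_top (a := U))).op).hom
  rw [h1] at h
  exact h

/-- `f ↦ f_X(1) : Hom(𝒪_X, G) → Γ(X, G)` is injective. [folklore] -/
theorem app_top_one_injective (G : X.Modules) :
    Function.Injective (fun f : unitModule X ⟶ G => f.app ⊤ (1 : X.presheaf.obj (op ⊤))) := by
  intro f g hfg
  apply G.unitHomEquiv.injective
  apply PresheafOfModules.sections_ext
  intro U
  change f.app U.unop (1 : X.presheaf.obj U) = g.app U.unop (1 : X.presheaf.obj U)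
  rw [app_one_eq_map_app_top_one G f, app_one_eq_map_app_top_one G g]
  exact congrArg _ hfg

/-- `f ↦ f_X(1) : Hom(𝒪_X, G) → Γ(X, G)` is surjective (`t ↦ (a ↦ a • t|_U)`). [folklore] -/
theorem app_top_one_surjective (G : X.Modules) :
    Function.Surjective (fun f : unitModule X ⟶ G => f.app ⊤ (1 : X.presheaf.obj (op ⊤))) := by
  intro t
  let s : G.sections := PresheafOfModules.sectionsMk
    (fun U => G.presheaf.map (homOfLE (le_top (a := U.unop))).op t) (fun U V i => by
      change G.presheaf.map i (G.presheaf.map _ t) = _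
      rw [← CategoryTheory.comp_apply, ← Functor.map_comp]
      rfl)
  refine ⟨G.unitHomEquiv.symm s, ?_⟩
  change (G.unitHomEquiv (G.unitHomEquiv.symm s)).val (op ⊤) = t
  rw [Equiv.apply_symm_apply]
  change G.presheaf.map (homOfLE (le_top (a := (⊤ : X.Opens)))).op t = t
  rw [show (homOfLE (le_top (a := (⊤ : X.Opens)))).op = 𝟙 _ from Subsingleton.elim _ _,
    CategoryTheory.Functor.map_id]
  rfl

variable [HasExt.{w} X.Modules]

/-- **`Ext⁰_{𝒪_X}(𝒪_X, G) → H⁰(X, G)` is bijective** (both are `Γ(X, G)`: Hartshorne III.6.3 (c) in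
degree `0`, `Hom(𝒪_X, G) = Γ(X, G)`). [cite: Hartshorne1977, III Prop. 6.3 (c)] -/
theorem extToCohomology_zero_bijective (G : X.Modules) :
    Function.Bijective (extToCohomology.{w} G 0) := by
  let e₁ : (unitModule X ⟶ G) ≃ Ext.{w} (unitModule X) G 0 := Ext.addEquiv₀.symm.toEquiv
  let e₂ := (Sheaf.H.equiv₀ ((modulesToSheaf X).obj G) isTerminalTop).toEquiv
  have h : (e₂ ∘ extToCohomology.{w} G 0 ∘ e₁) =
      fun f : unitModule X ⟶ G => f.app ⊤ (1 : X.presheaf.obj (op ⊤)) := by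
    funext f
    exact extToCohomology_mk₀_equiv₀ G f
  have hb : Function.Bijective (e₂ ∘ extToCohomology.{w} G 0 ∘ e₁) := by
    rw [h]
    exact ⟨app_top_one_injective G, app_top_one_surjective G⟩
  rwa [Equiv.comp_bijective, Equiv.bijective_comp] at hb

end DegreeZero

/-! ### Compatibility with connecting homomorphisms -/

section Delta

variable [HasExt.{w} X.Modules]

/-- `extToCohomology` commutes with the connecting homomorphisms of a short exact sequence of
`𝒪_X`-modules and of its (short exact) image in abelian sheaves: it is a morphism of
`δ`-functors. [cite: Hartshorne1977, III.1 (δ-functors) and III.6.3 (c)] -/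
theorem extToCohomology_comp_extClass {S : ShortComplex X.Modules} (hS : S.ShortExact)
    (n : ℕ) (x : Ext.{w} (unitModule X) S.X₃ n) :
    extToCohomology S.X₁ (n + 1) (x.comp hS.extClass rfl) =
      (extToCohomology S.X₃ n x).comp (hS.map_of_exact (modulesToSheaf X)).extClass rfl := by
  rw [extToCohomology_apply, extToCohomology_apply, Ext.mapExactFunctor_comp,
    Ext.mapExactFunctor_extClass]
  exact (Ext.comp_assoc _ _ _ (zero_add n) rfl (by omega)).symm

end Delta

/-! ### Hartshorne III.2.6 / III.6.3 (c): `Extⁱ(𝒪_X, G) ≅ Hⁱ(X, G)` -/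

section Comparison

variable [HasExt.{w} X.Modules]

/-- **`Extⁱ_{𝒪_X}(𝒪_X, G) → Hⁱ(X, G)` is bijective for every `𝒪_X`-module `G` on a scheme `X` and
every `i`** (Hartshorne III.6.3 (c) with III.2.6: the derived functors of `Γ(X, –)` on `Mod(𝒪_X)`
are `Ext(𝒪_X, –)` and agree with sheaf cohomology computed in `Ab(X)`). Proof: dimension shifting
along an injective presentation `0 → G → ℐ → Q → 0` in `Mod(𝒪_X)` (enough injectives,
`enoughInjectives_modules`); `ℐ` is flasque (`isFlasque_of_injective_modules`, III.2.4) hence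
`Γ`-acyclic (`subsingleton_H_of_isFlasque`, III.2.5), so both long exact sequences have a zero at
the right, and the four-lemma concludes from the inductive hypothesis at `ℐ` and `Q`.
[cite: Hartshorne1977, III Prop. 6.3 (c) and Prop. 2.6] -/
theorem extToCohomology_bijective (G : X.Modules) (n : ℕ) :
    Function.Bijective (extToCohomology.{w} G n) := by
  induction n generalizing G with
  | zero => exact extToCohomology_zero_bijective G
  | succ n hn =>
    let I : InjectivePresentation G := Classical.arbitrary _
    haveI := I.injective
    haveI := I.mono
    let S := ShortComplex.mk _ _ (cokernel.condition I.f)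
    have hS : S.ShortExact := { exact := ShortComplex.exact_cokernel I.f }
    haveI : TopCat.Sheaf.IsFlasque ((modulesToSheaf X).obj S.X₂) :=
      isFlasque_of_injective_modules I.J
    have hvan : Subsingleton (Sheaf.H (S.map (modulesToSheaf X)).X₂ (n + 1)) :=
      subsingleton_H_of_isFlasque ((modulesToSheaf X).obj S.X₂) (n + 1) (Nat.succ_pos n)
    exact AddMonoidHom.bijective_of_surjective_of_bijective_of_right_exact _ _ _ _
      (extToCohomology.{w} S.X₂ n) (extToCohomology.{w} S.X₃ n) (extToCohomology.{w} S.X₁ (n + 1))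
      (by ext x; exact (extToCohomology_comp_mk₀ S.g n x).symm)
      (by ext x; exact (extToCohomology_comp_extClass hS n x).symm)
      ((ShortComplex.ab_exact_iff_function_exact _).mp
        (Ext.covariant_sequence_exact₃' (unitModule X) hS n (n + 1) rfl))
      ((ShortComplex.ab_exact_iff_function_exact _).mp
        (Ext.covariant_sequence_exact₃' _ (hS.map_of_exact (modulesToSheaf X)) n (n + 1) rfl))
      (hn _).surjective (hn _)
      (fun x₁ => Ext.covariant_sequence_exact₁ _ hS x₁ (Ext.eq_zero_of_injective _) rfl)
      (fun y₁ => Ext.covariant_sequence_exact₁ _ (hS.map_of_exact (modulesToSheaf X)) y₁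
        (@Subsingleton.elim _ hvan _ _) rfl)

/-- **Hartshorne III.6.3 (c)** as an additive isomorphism `Extⁱ_{𝒪_X}(𝒪_X, G) ≃+ Hⁱ(X, G)`.
[cite: Hartshorne1977, III Prop. 6.3 (c)] -/
noncomputable def extUnitAddEquivCohomology (G : X.Modules) (n : ℕ) :
    Ext.{w} (unitModule X) G n ≃+ ((modulesToSheaf X).obj G).H n :=
  AddEquiv.ofBijective _ (extToCohomology_bijective G n)

/-- Vanishing transfers from sheaf cohomology to `Ext(𝒪_X, –)`: if `Hⁿ(X, G) = 0` then
`Extⁿ_{𝒪_X}(𝒪_X, G) = 0`. [cite: Hartshorne1977, III Prop. 6.3 (c)] -/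
theorem subsingleton_ext_unit_of_subsingleton_H (G : X.Modules) (n : ℕ)
    [h : Subsingleton (((modulesToSheaf X).obj G).H n)] :
    Subsingleton (Ext.{w} (unitModule X) G n) :=
  (extUnitAddEquivCohomology G n).toEquiv.subsingleton

/-- **Grothendieck vanishing for `Ext(𝒪_X, –)`**: on a scheme whose underlying space is
noetherian of dimension `< n`, `Extⁿ_{𝒪_X}(𝒪_X, G) = 0` for every `𝒪_X`-module `G`
(Hartshorne III.2.7 transported along III.6.3 (c)). [cite: Hartshorne1977, III Thm. 2.7 and Prop. 6.3 (c)] -/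
theorem subsingleton_ext_unit_of_topologicalKrullDim_lt [NoetherianSpace X] (G : X.Modules)
    {n : ℕ} (hn : topologicalKrullDim X < n) :
    Subsingleton (Ext.{w} (unitModule X) G n) :=
  haveI : Subsingleton (((modulesToSheaf X).obj G).H n) :=
    grothendieckVanishing_holds X.carrier ((modulesToSheaf X).obj G) n hn
  subsingleton_ext_unit_of_subsingleton_H G n

end Comparison

/-! ### Morphisms over `⊤` -/

section OverTop

variable {E M : X.Modules}

/-- `homOfTop` is a left inverse of restriction to `⊤`. [folklore] -/
theorem homOfTop_overFunctor_map (f : E ⟶ M) :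
    homOfTop ((SheafOfModules.overFunctor X.ringCatSheaf ⊤).map f) = f := by
  refine Scheme.Modules.hom_ext _ _ fun U => ?_
  ext s
  rw [homOfTop_app, appLE_over_map]

/-- `homOfTop` is a right inverse of restriction to `⊤`. [folklore] -/
theorem overFunctor_map_homOfTop (ψ : E.over ⊤ ⟶ M.over ⊤) :
    (SheafOfModules.overFunctor X.ringCatSheaf ⊤).map (homOfTop ψ) = ψ :=
  hom_ext_of_appLE fun W k s => by
    rw [appLE_over_map, homOfTop_app]
    exact appLE_congr_hom _ _ _ _

/-- Restriction to `⊤`, `Hom(E, M) → Hom(E|_⊤, M|_⊤)`, is bijective. [folklore] -/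
theorem overFunctor_top_map_bijective :
    Function.Bijective (fun f : E ⟶ M => (SheafOfModules.overFunctor X.ringCatSheaf ⊤).map f) :=
  ⟨fun f g h => by rw [← homOfTop_overFunctor_map f, ← homOfTop_overFunctor_map g]; exact congrArg _ h,
    fun ψ => ⟨homOfTop ψ, overFunctor_map_homOfTop ψ⟩⟩

end OverTop

/-! ### The comparison map `Extⁱ(E, M) → Extⁱ(𝒪_X, 𝓗om(E, M))` -/

section Map

variable [HasExt.{w} X.Modules] {E : X.Modules} (hE : IsFiniteLocallyFree E)

/-- **The comparison map `Extⁱ_{𝒪_X}(E, M) → Extⁱ_{𝒪_X}(𝒪_X, 𝓗om(E, M))`** for `E` finite locally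
free: apply the EXACT functor `𝓗om(E, –)` (`Modules.sheafHomFunctor E`,
`preservesFiniteColimits_sheafHomFunctor`) and precompose with the unit `𝒪_X → 𝓔nd(E)`
(`sheafHomUnit`). This is the isomorphism `Extⁱ(E, M) ≅ Extⁱ(𝒪_X, E^∨ ⊗ M) = Hⁱ(X, 𝓗om(E, M))`
of Hartshorne III.6.7 / III.6.3 (bijectivity: `extToExtUnitSheafHom_bijective`).
[cite: Hartshorne1977, III Prop. 6.7 and Prop. 6.3] -/
noncomputable def extToExtUnitSheafHom (M : X.Modules) (n : ℕ) :
    Ext.{w} E M n →+ Ext.{w} (unitModule X) (sheafHom E M) n :=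
  haveI := preservesFiniteColimits_sheafHomFunctor E hE
  ((Ext.mk₀ (sheafHomUnit E)).precomp (sheafHom E M) (zero_add n)).comp
    ((sheafHomFunctor E).mapExtAddHom E M n)

/-- Unfolding `extToExtUnitSheafHom`. [folklore] -/
theorem extToExtUnitSheafHom_apply (M : X.Modules) (n : ℕ) (x : Ext.{w} E M n) :
    extToExtUnitSheafHom hE M n x =
      haveI := preservesFiniteColimits_sheafHomFunctor E hE
      (Ext.mk₀ (sheafHomUnit E)).comp (x.mapExactFunctor (sheafHomFunctor E)) (zero_add n) :=
  rfl

/-- Naturality in `M`: the comparison map commutes with post-composition by `g : M → M'`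
(`𝓗om(E, g)` on the right). [folklore] -/
theorem extToExtUnitSheafHom_comp_mk₀ {M M' : X.Modules} (g : M ⟶ M') (n : ℕ)
    (x : Ext.{w} E M n) :
    extToExtUnitSheafHom hE M' n (x.comp (Ext.mk₀ g) (add_zero n)) =
      (extToExtUnitSheafHom hE M n x).comp (Ext.mk₀ (sheafHomMap E g)) (add_zero n) := by
  haveI := preservesFiniteColimits_sheafHomFunctor E hE
  rw [extToExtUnitSheafHom_apply, extToExtUnitSheafHom_apply, Ext.mapExactFunctor_comp,
    Ext.mapExactFunctor_mk₀]
  exact (Ext.comp_assoc_of_third_deg_zero _ _ _ _).symm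

/-- The comparison map commutes with the connecting homomorphisms of a short exact sequence and
of its (short exact) image under `𝓗om(E, –)`. [folklore] -/
theorem extToExtUnitSheafHom_comp_extClass {S : ShortComplex X.Modules} (hS : S.ShortExact)
    (n : ℕ) (x : Ext.{w} E S.X₃ n) :
    haveI := preservesFiniteColimits_sheafHomFunctor E hE
    extToExtUnitSheafHom hE S.X₁ (n + 1) (x.comp hS.extClass rfl) =
      (extToExtUnitSheafHom hE S.X₃ n x).comp
        (hS.map_of_exact (sheafHomFunctor E)).extClass rfl := by
  haveI := preservesFiniteColimits_sheafHomFunctor E hE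
  rw [extToExtUnitSheafHom_apply, extToExtUnitSheafHom_apply, Ext.mapExactFunctor_comp,
    Ext.mapExactFunctor_extClass]
  exact (Ext.comp_assoc _ _ _ (zero_add n) rfl (by omega)).symm

/-- In degree `0` the comparison map is `f ↦ (𝒪_X → 𝓔nd E → 𝓗om(E, M))`, `1 ↦ f|_U`.
[folklore] -/
theorem extToExtUnitSheafHom_mk₀ {M : X.Modules} (f : E ⟶ M) :
    extToExtUnitSheafHom hE M 0 (Ext.mk₀ f) = Ext.mk₀ (sheafHomUnit E ≫ sheafHomMap E f) := by
  haveI := preservesFiniteColimits_sheafHomFunctor E hE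
  rw [extToExtUnitSheafHom_apply, Ext.mapExactFunctor_mk₀]
  exact Ext.mk₀_comp_mk₀ _ _

/-- **Degree `0`**: `Hom(E, M) → Hom(𝒪_X, 𝓗om(E, M))` is bijective — both sides are the global
sections `Hom(E|_X, M|_X)` of `𝓗om(E, M)`. [cite: Hartshorne1977, III Prop. 6.3 (c) and Prop. 6.7] -/
theorem extToExtUnitSheafHom_zero_bijective (M : X.Modules) :
    Function.Bijective (extToExtUnitSheafHom hE M 0) := by
  -- conjugate by `Ext⁰ = Hom` on both sides and evaluate at `1 ∈ Γ(X, 𝒪_X)`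
  let e₁ : (E ⟶ M) ≃ Ext.{w} E M 0 := Ext.addEquiv₀.symm.toEquiv
  let e₂ : Ext.{w} (unitModule X) (sheafHom E M) 0 ≃ (unitModule X ⟶ sheafHom E M) :=
    Ext.addEquiv₀.toEquiv
  let ev : (unitModule X ⟶ sheafHom E M) → Γ(sheafHom E M, ⊤) :=
    fun g => g.app ⊤ (1 : X.presheaf.obj (op ⊤))
  have hev : Function.Bijective ev :=
    ⟨app_top_one_injective (sheafHom E M), app_top_one_surjective (sheafHom E M)⟩
  have h : ev ∘ e₂ ∘ extToExtUnitSheafHom hE M 0 ∘ e₁ =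
      fun f : E ⟶ M => (SheafOfModules.overFunctor X.ringCatSheaf ⊤).map f := by
    funext f
    change ev (Ext.addEquiv₀ (extToExtUnitSheafHom hE M 0 (Ext.addEquiv₀.symm f))) = _
    rw [Ext.addEquiv₀_symm_apply, extToExtUnitSheafHom_mk₀]
    change ((Ext.addEquiv₀ (Ext.mk₀ (sheafHomUnit E ≫ sheafHomMap E f))).app ⊤)
      (1 : X.presheaf.obj (op ⊤)) = _
    rw [show Ext.addEquiv₀ (Ext.mk₀ (sheafHomUnit E ≫ sheafHomMap E f)) =
        sheafHomUnit E ≫ sheafHomMap E f from Ext.addEquiv₀.symm.injective (by simp)]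
    change (sheafHomMap E f).app ⊤ ((sheafHomUnit E).app ⊤ (1 : X.presheaf.obj (op ⊤))) = _
    rw [sheafHomUnit_app_apply, overScalar_one, sheafHomMap_app_apply, Category.id_comp]
  have hb : Function.Bijective (ev ∘ e₂ ∘ extToExtUnitSheafHom hE M 0 ∘ e₁) := by
    rw [h]
    exact overFunctor_top_map_bijective
  exact (Equiv.bijective_comp e₁ _).mp
    ((Equiv.comp_bijective _ e₂).mp ((Function.Bijective.of_comp_iff' hev _).mp hb))

end Map

/-! ### Hartshorne III.6.7: `Extⁱ(E, M) ≅ Extⁱ(𝒪_X, 𝓗om(E, M)) ≅ Hⁱ(X, 𝓗om(E, M))` -/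

section ComparisonLocallyFree

variable [HasExt.{w} X.Modules] {E : X.Modules} (hE : IsFiniteLocallyFree E)

include hE

/-- **`Extⁱ_{𝒪_X}(E, M) → Extⁱ_{𝒪_X}(𝒪_X, 𝓗om(E, M))` is bijective** for `E` finite locally free
(Hartshorne III.6.7: `Extⁱ(E, M) ≅ Extⁱ(𝒪_X, E^∨ ⊗ M)`, with III.6.3 (c)). Dimension shifting along
an injective presentation `0 → M → ℐ → Q → 0`: `Extⁱ⁺¹(E, ℐ) = 0`, and `𝓗om(E, ℐ)` is flasque
(`isFlasque_sheafHom`, ℐ being flasque by III.2.4) hence acyclic for `Ext(𝒪_X, –) = H(X, –)`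
(`extToCohomology_bijective`, III.2.5), so the four-lemma applies to the two long exact sequences
(`𝓗om(E, –)` is exact). [cite: Hartshorne1977, III Prop. 6.7] -/
theorem extToExtUnitSheafHom_bijective (M : X.Modules) (n : ℕ) :
    Function.Bijective (extToExtUnitSheafHom hE M n) := by
  haveI := preservesFiniteColimits_sheafHomFunctor E hE
  induction n generalizing M with
  | zero => exact extToExtUnitSheafHom_zero_bijective hE M
  | succ n hn =>
    let I : InjectivePresentation M := Classical.arbitrary _
    haveI := I.injective
    haveI := I.mono
    let S := ShortComplex.mk _ _ (cokernel.condition I.f)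
    have hS : S.ShortExact := { exact := ShortComplex.exact_cokernel I.f }
    -- `𝓗om(E, ℐ)` is flasque, hence `Ext(𝒪_X, –)`-acyclic
    haveI : TopCat.Sheaf.IsFlasque ((SheafOfModules.toSheaf X.ringCatSheaf).obj S.X₂) :=
      isFlasque_of_injective_modules I.J
    haveI : TopCat.Sheaf.IsFlasque ((modulesToSheaf X).obj (sheafHom E S.X₂)) :=
      isFlasque_sheafHom hE S.X₂
    haveI : Subsingleton (((modulesToSheaf X).obj (sheafHom E S.X₂)).H (n + 1)) :=
      subsingleton_H_of_isFlasque _ (n + 1) (Nat.succ_pos n)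
    have hvan : Subsingleton (Ext.{w} (unitModule X) (S.map (sheafHomFunctor E)).X₂ (n + 1)) :=
      subsingleton_ext_unit_of_subsingleton_H (sheafHom E S.X₂) (n + 1)
    exact AddMonoidHom.bijective_of_surjective_of_bijective_of_right_exact _ _ _ _
      (extToExtUnitSheafHom hE S.X₂ n) (extToExtUnitSheafHom hE S.X₃ n)
      (extToExtUnitSheafHom hE S.X₁ (n + 1))
      (by ext x; exact (extToExtUnitSheafHom_comp_mk₀ hE S.g n x).symm)
      (by ext x; exact (extToExtUnitSheafHom_comp_extClass hE hS n x).symm)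
      ((ShortComplex.ab_exact_iff_function_exact _).mp
        (Ext.covariant_sequence_exact₃' E hS n (n + 1) rfl))
      ((ShortComplex.ab_exact_iff_function_exact _).mp
        (Ext.covariant_sequence_exact₃' _ (hS.map_of_exact (sheafHomFunctor E)) n (n + 1) rfl))
      (hn _).surjective (hn _)
      (fun x₁ => Ext.covariant_sequence_exact₁ _ hS x₁ (Ext.eq_zero_of_injective _) rfl)
      (fun y₁ => Ext.covariant_sequence_exact₁ _ (hS.map_of_exact (sheafHomFunctor E)) y₁
        (@Subsingleton.elim _ hvan _ _) rfl)

/-- **Hartshorne III.6.7** as an additive isomorphism `Extⁱ(E, M) ≃+ Extⁱ(𝒪_X, 𝓗om(E, M))`.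
[cite: Hartshorne1977, III Prop. 6.7] -/
noncomputable def extAddEquivExtUnitSheafHom (M : X.Modules) (n : ℕ) :
    Ext.{w} E M n ≃+ Ext.{w} (unitModule X) (sheafHom E M) n :=
  AddEquiv.ofBijective _ (extToExtUnitSheafHom_bijective hE M n)

/-- **Hartshorne III.6.3 (c) + III.6.7**: `Extⁱ_{𝒪_X}(E, M) ≃+ Hⁱ(X, 𝓗om(E, M))` for `E` finite
locally free. [cite: Hartshorne1977, III Prop. 6.3 (c) and Prop. 6.7] -/
noncomputable def extAddEquivCohomologySheafHom (M : X.Modules) (n : ℕ) :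
    Ext.{w} E M n ≃+ ((modulesToSheaf X).obj (sheafHom E M)).H n :=
  (extAddEquivExtUnitSheafHom hE M n).trans (extUnitAddEquivCohomology (sheafHom E M) n)

/-- Vanishing transfers from the cohomology of `𝓗om(E, M)` to `Ext(E, M)`.
[cite: Hartshorne1977, III Prop. 6.7] -/
theorem subsingleton_ext_of_subsingleton_H_sheafHom (M : X.Modules) (n : ℕ)
    [Subsingleton (((modulesToSheaf X).obj (sheafHom E M)).H n)] :
    Subsingleton (Ext.{w} E M n) :=
  (extAddEquivCohomologySheafHom hE M n).toEquiv.subsingleton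

/-- **`Extⁱ_{𝒪_X}(E, M) = 0` for `i > dim X`**, `E` finite locally free, on a scheme whose underlying
space is noetherian of dimension `< i` (Hartshorne III.6.7 with Grothendieck's vanishing theorem
III.2.7). [cite: Hartshorne1977, III Prop. 6.7 and Thm. 2.7] -/
theorem subsingleton_ext_of_topologicalKrullDim_lt [NoetherianSpace X] (M : X.Modules) {n : ℕ}
    (hn : topologicalKrullDim X < n) : Subsingleton (Ext.{w} E M n) :=
  haveI : Subsingleton (((modulesToSheaf X).obj (sheafHom E M)).H n) :=
    grothendieckVanishing_holds X.carrier ((modulesToSheaf X).obj (sheafHom E M)) n hn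
  subsingleton_ext_of_subsingleton_H_sheafHom hE M n

end ComparisonLocallyFree

end Literature.AlgebraicGeometry.Modules
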